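import Summits.CriticalPhenomena.PercolationContinuityZ3.Theorems.PercNearOneGluingNoHeavyLowerTailMajorityGluingSixTwo
import Summits.CriticalPhenomena.PercolationContinuityZ3.Theorems.PercNearOneGluingNoHeavyLowerTailMajorityGluing
import HarnessLib

/-!
# `C(7) = 2`: majority gluing at `|A| = 7` loses exactly `2·max` — the weak cell `(5,4)` from the weak cell `(4,3)` by monotonicity (lane prim-rate, constants-miner 1, gen 32; SUMMARY-M1-L2.md, CANDIDATES §GEN-4 R16 / §GEN-31 / §GEN-32)

Support file for the closed crux `NoHeavyLowerTail` (stmt-CriticalPhenomena-4575), majority-gluing line, continuing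
`…MajorityGluingSixTwo.lean` (gen 31: `HubOnly.weakEKR43`, `HubOnly.majorityGluing_two_card_six` — `C(6) = 2`) and
`…MajorityGluingHubOnlyWeakAt.lean` (gen 3: `C(k) = 2 ⟸` the weak percolation-EKR cell `(k − 2, ⌈k/2⌉)`).

THE OBSERVATION (gen 4, CANDIDATES §GEN-4 R16, there spent on the false bound `maj3`).  The window cells are MONOTONE:
`{h + j ≤ #cut T} ⊆ {h ≤ #cut T'}` for every `T' ⊆ T` with `|T| = |T'| + j` (a relay of `T` outside `T'` accounts for at most one cut).
Hence the weak cell `(m, h)` («`|T| = m`, `T ∌ a₀`, cut probabilities `≤ δ ≤ 1/2` ⟹ `μ(h ≤ #cut T) ≤ δ/(1−δ)`») implies the weak cell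
`(m + j, h + j)` (`cutCount_mono`), and a cell `(m, h)` with `m + 2 = 2h` supplies the hypothesis `WeakAt(A, a₀)` of
`HubOnly.majorityGluing_two_of_weakEKR_at` at BOTH sizes `|A| = m + 2` (cell `(m, h)`) and `|A| = m + 3` (cell `(m + 1, h + 1)`)
(`weakEKR_at_of_cell`, `majorityGluing_two_of_cell`): **`C(2h) = 2 ⟹ C(2h + 1) = 2`**.  With gen 31's kernel theorem `weakEKR43`
(the cell `(4,3)` on the whole range `δ ∈ [0, 1/2]`):
* `weakEKR54` — hub `a₀ ∉ T`, `|T| = 5`, `0 ≤ δ ≤ 1/2` bounding the cut probabilities on `T`: **`μ(at least four of T cut) ≤ δ/(1−δ)`**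
  (the tree had `(16875/16384)·δ`, `fourOfFive_count`, van den Berg–Kahn);
* `majorityGluing_two_card_seven` — for every weight function, observer `o`, hub `a₀ ∈ A`, `|A| = 7`, `δ₀ ≥ max_{a∈A} μ(a ↮ a₀)`:
  **`μ(o ↔ A) − 2·δ₀ ≤ μ(o ↔ a₀ ∧ 2N > 7)`** — the majority-gluing constant at `|A| = 7` IS `2` (the tree had `33259/16384`,
  `majorityGluing_vdBK_card_seven`; `2` is sharp by the lane's path family, CANDIDATES §GEN-2);
* `majorityGluing_two_of_card_le_seven` — loss `2·max` at EVERY relay set with `|A| ≤ 7` (sizes `≤ 5`: p308121; `6, 7`: the cell `(4,3)`).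
The next cell of the window is `(6,4)` (`|A| = 8`; it would give `|A| = 9` for free by the same monotonicity); it is not implied by `(4,3)`.
No definitions, no named facts, no sorries. [cite: KozmaNitzan2024, Conj. 1 (p. 3), Conj. 4 (p. 32)] [cite: VandenbergKahn2001, Thm 1.2 (p. 123)]
-/

noncomputable section

namespace Summit.CriticalPhenomena.PercolationContinuityZ3.Theorems

open MeasureTheory Set
open Literature.Probability.LatticeModels (prodBernoulli)
open Literature.Probability.Percolation
open scoped Classical

namespace HubOnly

variable {n : ℕ}

/-- **Counting core of the cell monotonicity.** For `T' ⊆ T`, the elements of `T` satisfying `P` exceed those of `T'` by at most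
`|T| − |T'|`. [folklore] -/
theorem card_filter_le_card_filter_add_card_sub {α : Type*} [DecidableEq α] (T T' : Finset α) (P : α → Prop)
    [DecidablePred P] (hsub : T' ⊆ T) : (T.filter P).card ≤ (T'.filter P).card + (T.card - T'.card) := by
  have h1 := Finset.card_filter_add_card_filter_not (s := T) P
  have h2 := Finset.card_filter_add_card_filter_not (s := T') P
  have h3 : (T'.filter fun x => ¬ P x).card ≤ (T.filter fun x => ¬ P x).card :=
    Finset.card_le_card (Finset.filter_subset_filter _ hsub)
  have h4 : T'.card ≤ T.card := Finset.card_le_card hsub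
  omega

/-- **MONOTONICITY OF THE WEAK CELLS** (fixed weight function, hub, marginal bound `δ` and value `B`).  If every `m`-set `T ∌ a₀` of
relays with cut probabilities `≤ δ` has `μ(h ≤ #cut T) ≤ B`, then every set `T ∌ a₀` with `|T| ≥ m`, cut probabilities `≤ δ`, and every
threshold `h' ≥ h + (|T| − m)` has `μ(h' ≤ #cut T) ≤ B`: `{h' ≤ #cut T} ⊆ {h ≤ #cut T₀}` for any `m`-subset `T₀ ⊆ T`. [folklore] -/
theorem cutCount_mono (w : Sym2 (Fin n) → unitInterval) (a₀ : Fin n) (m h : ℕ) (δ B : ℝ)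
    (hcell : ∀ T : Finset (Fin n), T.card = m → a₀ ∉ T →
      (∀ u ∈ T, (prodBernoulli w).real (openConn u a₀ : Set (BondConfig (Fin n)))ᶜ ≤ δ) →
      (prodBernoulli w).real {ω : BondConfig (Fin n) | h ≤ (T.filter fun u => ω ∉ openConn u a₀).card} ≤ B)
    (T : Finset (Fin n)) (h' : ℕ) (hm : m ≤ T.card) (hh' : h + (T.card - m) ≤ h') (haT : a₀ ∉ T)
    (hδT : ∀ u ∈ T, (prodBernoulli w).real (openConn u a₀ : Set (BondConfig (Fin n)))ᶜ ≤ δ) :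
    (prodBernoulli w).real {ω : BondConfig (Fin n) | h' ≤ (T.filter fun u => ω ∉ openConn u a₀).card} ≤ B := by
  obtain ⟨T₀, hT₀T, hT₀card⟩ := Finset.exists_subset_card_eq hm
  have haT₀ : a₀ ∉ T₀ := fun h₀ => haT (hT₀T h₀)
  have hsub : {ω : BondConfig (Fin n) | h' ≤ (T.filter fun u => ω ∉ openConn u a₀).card} ⊆
      {ω : BondConfig (Fin n) | h ≤ (T₀.filter fun u => ω ∉ openConn u a₀).card} := by
    intro ω hω
    simp only [mem_setOf_eq] at hω ⊢
    have hc := card_filter_le_card_filter_add_card_sub T T₀ (fun u => ω ∉ openConn u a₀) hT₀T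
    omega
  exact (measureReal_mono hsub).trans (hcell T₀ hT₀card haT₀ (fun u hu => hδT u (hT₀T hu)))

/-- **THE WEAK PERCOLATION-EKR CELL `(5,4)`** (constants-miner 1, gen 32; BENCH «C(7) = 2»).  For every finite weighted graph, hub `a₀`,
five relays `T ∌ a₀` and `0 ≤ δ ≤ 1/2` with `μ(u ↮ a₀) ≤ δ` on `T`:  `μ(at least four relays of T cut from a₀) ≤ δ/(1 − δ)`.
Proof: `{4 ≤ #cut T} ⊆ {3 ≤ #cut T₀}` for any 4-subset `T₀`, and the cell `(4,3)` (`weakEKR43`, gen 31: van den Berg–Kahn above `13/256`,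
the kernel `(4,3)` programme below). [cite: VandenbergKahn2001, Thm 1.2 (p. 123)] [cite: KozmaNitzan2024, Conj. 4 (p. 32)] -/
theorem weakEKR54 (w : Sym2 (Fin n) → unitInterval) (a₀ : Fin n) (T : Finset (Fin n)) (hT : T.card = 5) (haT : a₀ ∉ T) (δ : ℝ)
    (hδ0 : 0 ≤ δ) (hδ1 : δ ≤ 1 / 2) (hδT : ∀ u ∈ T, (prodBernoulli w).real (openConn u a₀ : Set (BondConfig (Fin n)))ᶜ ≤ δ) :
    (prodBernoulli w).real {ω : BondConfig (Fin n) | 4 ≤ (T.filter fun u => ω ∉ openConn u a₀).card} ≤ δ / (1 - δ) :=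
  cutCount_mono w a₀ 4 3 δ (δ / (1 - δ)) (fun T₀ hT₀ haT₀ hδT₀ => weakEKR43 w a₀ T₀ hT₀ haT₀ δ hδ0 hδ1 hδT₀) T 4
    (by omega) (by omega) haT hδT

/-- **A cell `(m, h)` with `m + 2 = 2h` supplies `WeakAt(A, a₀)` at both sizes `|A| = m + 2` and `|A| = m + 3`.**  The hypothesis of
`HubOnly.majorityGluing_two_of_weakEKR_at` asks, for `T ⊆ A ∖ {a₀}` with `|T| + 2 = |A|`, the bound `μ(⌈|A|/2⌉ ≤ #cut T) ≤ δ/(1−δ)`;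
at `|A| = m + 2` this is the cell `(m, h)` itself, at `|A| = m + 3` it is the cell `(m + 1, h + 1)`, implied by monotonicity (`cutCount_mono`).
So `C(2h) = 2 ⟹ C(2h + 1) = 2` along the window `(4,3), (5,4), (6,4), (7,5), …`. [cite: KozmaNitzan2024, Conj. 4 (p. 32)] -/
theorem weakEKR_at_of_cell (A : Finset (Fin n)) (a₀ : Fin n) (m h : ℕ) (hmh : m + 2 = 2 * h)
    (hAm : m + 2 ≤ A.card) (hAm' : A.card ≤ m + 3)
    (hcell : ∀ (p : Sym2 (Fin n) → unitInterval) (T : Finset (Fin n)) (δ : ℝ), T.card = m → a₀ ∉ T → 0 ≤ δ → δ ≤ 1 / 2 →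
      (∀ u ∈ T, (prodBernoulli p).real (openConn u a₀ : Set (BondConfig (Fin n)))ᶜ ≤ δ) →
      (prodBernoulli p).real {ω : BondConfig (Fin n) | h ≤ (T.filter fun u => ω ∉ openConn u a₀).card} ≤ δ / (1 - δ)) :
    ∀ (p : Sym2 (Fin n) → unitInterval), (∀ e, 0 < p e ∧ p e < 1) →
      ∀ (T : Finset (Fin n)) (δ : ℝ), a₀ ∉ T → T ⊆ A → T.card + 2 = A.card → 0 ≤ δ → δ ≤ 1 / 2 →
      (∀ v ∈ T, (prodBernoulli p).real (openConn v a₀ : Set (BondConfig (Fin n)))ᶜ ≤ δ) →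
      (prodBernoulli p).real {ω : BondConfig (Fin n) | (A.card + 1) / 2 ≤ (T.filter fun v => ω ∉ openConn v a₀).card} ≤
        δ / (1 - δ) := by
  intro p _ T δ ha₀T _ hTcard hδ0 hδ1 hδT
  exact cutCount_mono p a₀ m h δ (δ / (1 - δ)) (fun T₀ hT₀ haT₀ hδT₀ => hcell p T₀ δ hT₀ haT₀ hδ0 hδ1 hδT₀) T
    ((A.card + 1) / 2) (by omega) (by omega) ha₀T hδT

/-- **MAJORITY GLUING WITH LOSS `2·max` AT `|A| ∈ {m + 2, m + 3}` FROM THE WEAK CELL `(m, h)`, `m + 2 = 2h`** (for every weight function,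
observer `o`, hub `a₀ ∈ A` and `δ₀ ≥ max_{a∈A} μ(a ↮ a₀)`:  `μ(o ↔ A) − 2·δ₀ ≤ μ(o ↔ a₀ ∧ 2N > |A|)`), via
`HubOnly.majorityGluing_two_of_weakEKR_at` (p317647) and `weakEKR_at_of_cell`. [cite: KozmaNitzan2024, Conj. 1 (p. 3), Conj. 4 (p. 32)] -/
theorem majorityGluing_two_of_cell (w : Sym2 (Fin n) → unitInterval) (A : Finset (Fin n)) (o a₀ : Fin n) (δ₀ : ℝ)
    (ha₀ : a₀ ∈ A) (m h : ℕ) (hmh : m + 2 = 2 * h) (hAm : m + 2 ≤ A.card) (hAm' : A.card ≤ m + 3)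
    (hcell : ∀ (p : Sym2 (Fin n) → unitInterval) (T : Finset (Fin n)) (δ : ℝ), T.card = m → a₀ ∉ T → 0 ≤ δ → δ ≤ 1 / 2 →
      (∀ u ∈ T, (prodBernoulli p).real (openConn u a₀ : Set (BondConfig (Fin n)))ᶜ ≤ δ) →
      (prodBernoulli p).real {ω : BondConfig (Fin n) | h ≤ (T.filter fun u => ω ∉ openConn u a₀).card} ≤ δ / (1 - δ))
    (hδ₀ : ∀ a ∈ A, (prodBernoulli w).real (openConn a a₀ : Set (BondConfig (Fin n)))ᶜ ≤ δ₀) :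
    (prodBernoulli w).real (⋃ a ∈ A, openConn o a) - 2 * δ₀ ≤
      (prodBernoulli w).real {ω : BondConfig (Fin n) | ω ∈ openConn o a₀ ∧
          A.card < 2 * (A.filter fun a => ω ∈ openConn o a).card} :=
  majorityGluing_two_of_weakEKR_at w A o a₀ δ₀ ha₀ (weakEKR_at_of_cell A a₀ m h hmh hAm hAm' hcell) hδ₀

/-- **`C(7) = 2`: MAJORITY GLUING AT `|A| = 7` LOSES EXACTLY `2·max`** (constants-miner 1, gen 32).  For every finite weighted graph,
observer `o`, hub `a₀ ∈ A`, `|A| = 7` and `δ₀ ≥ max_{a∈A} μ(a ↮ a₀)`:  `μ(o ↔ A) − 2·δ₀ ≤ μ(o ↔ a₀ ∧ 2N > 7)`, `N = #{a ∈ A : o ↔ a}`.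
From the cell `(4,3)` (`weakEKR43`, gen 31) through the cell `(5,4)`; improves `majorityGluing_vdBK_card_seven` (`33259/16384`); the
constant `2` is attained in the limit by the lane's path family (CANDIDATES §GEN-2). [cite: KozmaNitzan2024, Conj. 1 (p. 3)]
[cite: VandenbergKahn2001, Thm 1.2 (p. 123)] -/
theorem majorityGluing_two_card_seven (w : Sym2 (Fin n) → unitInterval) (A : Finset (Fin n)) (o a₀ : Fin n) (δ₀ : ℝ)
    (ha₀ : a₀ ∈ A) (hA : A.card = 7) (hδ₀ : ∀ a ∈ A, (prodBernoulli w).real (openConn a a₀ : Set (BondConfig (Fin n)))ᶜ ≤ δ₀) :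
    (prodBernoulli w).real (⋃ a ∈ A, openConn o a) - 2 * δ₀ ≤
      (prodBernoulli w).real {ω : BondConfig (Fin n) | ω ∈ openConn o a₀ ∧
          A.card < 2 * (A.filter fun a => ω ∈ openConn o a).card} :=
  majorityGluing_two_of_cell w A o a₀ δ₀ ha₀ 4 3 (by norm_num) (by omega) (by omega)
    (fun p T δ hT haT hδ0 hδ1 hδT => weakEKR43 p a₀ T hT haT δ hδ0 hδ1 hδT) hδ₀

/-- **MAJORITY GLUING WITH LOSS `2·max` AT EVERY RELAY SET OF SIZE `≤ 7`** (the lane's table, SUMMARY-M1-L2.md: `C(k) = 1` for `k ≤ 3`,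
`= 2` for `4 ≤ k ≤ 7`; `C(k) < 3` always and `→ 3`).  For every weight function, observer `o`, hub `a₀ ∈ A`, `|A| ≤ 7` and
`δ₀ ≥ max_{a∈A} μ(a ↮ a₀)`:  `μ(o ↔ A) − 2·δ₀ ≤ μ(o ↔ a₀ ∧ 2N > |A|)`.  Sizes `≤ 5`: `majorityGluing_two_of_card_le_five` (p308121,
additive gluing); sizes `6, 7`: the cell `(4,3)`. [cite: KozmaNitzan2024, Conj. 1 (p. 3)] [cite: VandenbergKahn2001, Thm 1.2 (p. 123)] -/
theorem majorityGluing_two_of_card_le_seven (w : Sym2 (Fin n) → unitInterval) (A : Finset (Fin n)) (o a₀ : Fin n) (δ₀ : ℝ)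
    (ha₀ : a₀ ∈ A) (hA : A.card ≤ 7) (hδ₀ : ∀ a ∈ A, (prodBernoulli w).real (openConn a a₀ : Set (BondConfig (Fin n)))ᶜ ≤ δ₀) :
    (prodBernoulli w).real (⋃ a ∈ A, openConn o a) - 2 * δ₀ ≤
      (prodBernoulli w).real {ω : BondConfig (Fin n) | ω ∈ openConn o a₀ ∧
          A.card < 2 * (A.filter fun a => ω ∈ openConn o a).card} := by
  by_cases h5 : A.card ≤ 5
  · exact majorityGluing_two_of_card_le_five n w A o a₀ δ₀ ha₀ h5 hδ₀
  · exact majorityGluing_two_of_cell w A o a₀ δ₀ ha₀ 4 3 (by norm_num) (by omega) (by omega)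
      (fun p T δ hT haT hδ0 hδ1 hδT => weakEKR43 p a₀ T hT haT δ hδ0 hδ1 hδT) hδ₀

end HubOnly

end Summit.CriticalPhenomena.PercolationContinuityZ3.Theorems

end
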